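import Literature.MathematicalPhysics.QuantumFieldTheory.Balaban1983to89.B15Ineq137Local
import Literature.MathematicalPhysics.QuantumFieldTheory.Balaban1983to89.B15Ineq158Bound

/-!
# `Balaban1983to89.B15Ineq154From190` — [Balaban1989LargeFieldI] (1.54)/(1.58) pp. 187–188, the second expression of (1.54)
# *"is much smaller than δ′_j. This we will show later"* — ON THE LATTICE MODEL, END-TO-END FROM [15] (190): the (1.41)-type
# mechanism *"ℍ_Z^{(j)} is given by the formula corresponding to (1.41)"* is p29's `B15Ineq137Local.ineq137_local` (the
# standard-representation deviation of the `j`-fold average, gauge fixing `glev`), the size of `ℍ^{(n+1)}_{k,Z}` comes from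
# (1.57) via (190) (`B15Ineq158Bound.boundHZ158_of_ineq190`), and *"much smaller than δ′_j"* from the γ-clause
# (`B15Ineq158Bound.smallness158_hyp_of_gamma`)

statement-level skeleton of published theorems with citation tags; proofs where landed; nothing here is a claim about
the Yang–Mills mass gap.

CITATION HEADER (lean-in-tree rule 2026-08-18).  T. Bałaban, *Large field renormalization. I. The basic step of the 𝐑
operation*, Commun. Math. Phys. **122**, 175–202 (1989), doi:10.1007/BF01257412, bib `Balaban1989LargeFieldI` (cell paper
B15; PDF held `paper:balaban1989-cmp122-large-field-i`; pp. 187–188 = PDF 13–14, OCR `p0013.txt`/`p0014.txt` + x2 renders).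
"[15]" = [Balaban1985Variational] (190) p. 308; "[3]" = [Balaban1984PropagatorsII] (2.61); "[12]" = [Balaban1985Averaging]
(106)–(108)/(159)–(166); "[III]" = [Balaban1988Convergent] (2.4)/(2.5)/(2.8).  WHAT IS REPRODUCED: SKELETON rows `B15.Eq1.54`
(second expression), `B15.Eq1.58` (bound), `B15.Eq1.57`, unit `lit-balaban-r12` gen 8, HOME `run/shared/lean/pub/lit-balaban/`
(`lit-balaban-r12/ROWS-B15.md`).  KNITTING — used BY NAME, nothing restated: `B15Ineq137Local.ineq137_local` (p29 g6),
`B15Ineq158Bound.boundHZ158_of_ineq190`, `B15Ineq158Bound.smallness158_hyp_of_gamma` (r12 g8).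

THE PRINTED TEXT (pp. 187–188, verbatim): *"This field is small, because |V′_j − 1| ≤ |V_j(V_Z^{(j)})^{−1} − 1| +
|V_Z^{(j)}(V^{(j)})^{−1} − 1| < 3δ′_j (1.54) by (1.27), and by the fact that the second expression on the right-hand side is
much smaller than δ′_j. This we will show later. … For the averages V^{(j)}, V_Z^{(j)} we have, as in (1.40) V^{(j)} =
exp iℍ_Z^{(j)}V_Z^{(j)}, (1.58) where ℍ_Z^{(j)} is given by the formula corresponding to (1.41). It is … bounded by
O(1)exp(−R_j)ε_j."*

WHAT THIS FILE PROVES (kernel-checked, zero `sorry`; no `def`, no new `Prop`, no new named fact; axioms standard).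
* `second154_le_lattice_of_ineq190` — for p29's lattice deviation `dev = |M^j((e^{iL^{−j}ℍ}U₀)^{u⁻¹})(b)·M^j(U₀)(b)⁻¹ − 1|`
  (`U₀ = U^{(n+1)}_{k,Z}`, `ℍ = ℍ^{(n+1)}_{k,Z}`, `u = glev`; this is `|V^{(j)}(b)V_Z^{(j)}(b)⁻¹ − 1| = |exp iℍ_Z^{(j)}(b) − 1|`):
  `dev ≤ (136(d+1)+320d)·44d²B₃²(1+β₀)·exp(−R_j)·ε_j` — print's `O(1)exp(−R_j)ε_j` with `O(1)` explicit — from (190) for the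
  block size `bout` at the base point `y` ((1.57)₁: argument field `≤ 44d²B₃ε_k` in the `2Mχ`-layer at `∂Z` at distance `≥ D`,
  `δ10M·ΣR_l + δMR_k ≤ τD`, `Cκ_Bc ≤ B₃`, mean-value domination), (1.57)₂ for abstract sizes (`R_l ≥ 1`, `R_l ≤ L·R_{l+1}`,
  `δM ≥ L+1`, the (2.8) input), the dictionary `hdom` on `B^j(b₋) ∪ B^j(b₊)` against `s = L^{k−j−1}·bout.loc y ℍB`, and p29's
  located `s`-conditions.
* `second154_lt_lattice_of_ineq190_gamma` — `dev < δ′_j` (*"much smaller than δ′_j"*): the above and the γ-clause of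
  `smallness158_hyp_of_gamma` (`R_j` of (2.5) with `r ≥ 1`, `0 < g_j ≤ γ`, `log γ⁻² ≥ 1`, `p₁ ≤ p₀`, letters
  `ε_j = g_jA₀(log g_j⁻²)^{p₀}`, `δ′_j = g_jA₁(log g_j⁻²)^{p₁}`, clause `C·A₀(2(p₀−p₁))^{p₀−p₁}γ < A₁` with
  `C = (136(d+1)+320d)44d²B₃²(1+β₀)`).  The triangle step of (1.54) itself is `B15Ineq154Proof.ineq154(_full)`.
* §2 (v1.1) `second154_lt_lattice_of_ineq190_gamma'` — the same with p29's four located `s`-conditions DERIVED (by (1.57) from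
  (190): `s < 44d²B₃²(1+β₀)e^{−R_j}ε_j ≤ 44d²B₃²(1+β₀)γ²`, `ε_j ≤ 1`) from three explicit clauses in γ and the (52)-parameter `α₀`.
HONEST SCOPE.  (190), the dictionary and (v1: p29's located side conditions) are hypotheses; `R_j` of the flow chain is identified
with the (2.5) integer `R` (`hRj`).  NOT summit progress.
-/

open NormedSpace Finset

namespace Literature.MathematicalPhysics.QuantumFieldTheory.Balaban1983to89.B15Ineq154From190

open Literature.MathematicalPhysics.QuantumFieldTheory.Balaban1983to89
open B7Prop1Explicit B7Prop2Explicit B7Prop3Flat B7Eq92Concrete B7Eq99Concrete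
open B11SectG B15.BasicStep B15HDecayLeaves B15Ineq137Local B15Ineq158Bound

/-- **(1.58)'s bound for the second expression of (1.54), ON THE LATTICE, FROM [15] (190)** (`ineq137_local` ∘ `hdom` ∘
`boundHZ158_of_ineq190`). [cite: Balaban1989LargeFieldI, (1.54) p.187, (1.57)–(1.58) p.188; Balaban1985Variational, (190) p.308] -/
theorem second154_le_lattice_of_ineq190
    -- [15]'s block-majorant data for (1.57)
    {gB : B6.Geometry} {FB FA : Type} [AddCommGroup FB] [Module ℝ FB] [AddCommGroup FA] [Module ℝ FA]
    {T : Type*} {bB : BlockNorm gB FB} {bout : BlockNorm gB FA} {dH : T → FB →ₗ[ℝ] FA}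
    {C δ₀ σ τ c D B₃ δ M εk εj β₀ Lr : ℝ} {R : ℕ → ℝ} {j k : ℕ}
    (h190 : ∀ t, Ineq190 bB bout (dH t) C δ₀) (hC : 0 ≤ C) (hd : ∀ a b : gB.Site, 0 ≤ gB.dist a b)
    (hrow : RowSum gB σ c) (hτ : 0 ≤ τ) (hστ : σ + τ ≤ δ₀ / 8) (B : FB) (y : gB.Site)
    -- the lattice data (p29's `ineq137_local`)
    {d : ℕ} {𝔸 : Type*} [NormedRing 𝔸] [NormedAlgebra ℂ 𝔸] [CompleteSpace 𝔸] [NormOneClass 𝔸]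
    {L : ℕ} (hL : 2 ≤ L) {G : Subgroup 𝔸ˣ} (hG : AvgClosed d L G)
    {U₀ : B7Prop1Explicit.Site d → Fin d → 𝔸ˣ} (hU₀ : ∀ x κ, U₀ x κ ∈ G) {α₀ : ℝ} (hα : 0 < α₀)
    (hα3 : C0 d * α₀ ≤ 1 / 3) (hα4 : 4 * α₀ ≤ c2' d L) (h52 : pdev U₀ < α₀ * (((L : ℝ) ^ j)⁻¹) ^ 2)
    (H : B7Prop1Explicit.Site d → Fin d → 𝔸) (q : B7Prop1Explicit.Site d) (κ : Fin d)
    (hm : ∀ y', bB.loc y' B ≤ 44 * (d : ℝ) ^ 2 * B₃ * εk) (hD : ∀ y', bB.loc y' B ≠ 0 → D ≤ gB.dist y y')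
    {HB : FA} (hmv : ∀ s : ℝ, (∀ t, bout.loc y (dH t B) ≤ s) → bout.loc y HB ≤ s)
    (hgeom : δ * 10 * M * (∑ l ∈ Finset.Ico (j + 1) k, R l) + δ * M * R k ≤ τ * D) (hCB : C * bB.κ * c ≤ B₃)
    (hjk : j < k) (hLr : 2 ≤ Lr) (hδM : Lr + 1 ≤ δ * M) (hR1 : ∀ l, 1 ≤ R l)
    (hstep : ∀ l, j ≤ l → l < k → R l ≤ Lr * R (l + 1)) (hεk : εk ≤ (1 + β₀) * Real.sqrt ((k : ℝ) - j) * εj)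
    (hεk0 : 0 ≤ εk) (hεj : 0 < εj) (hβ₀ : 0 ≤ β₀) (hB₃ : 0 < B₃) (hdpos : 0 < d)
    -- the dictionary, against `s = L^{k−j−1}·(block size)`
    (hdom : ∀ y' μ, B7Prop1Local.InBox (B7Prop1Local.loK L j q) (B7Prop1Local.bondHiK L j q κ) y' →
      ‖H y' μ‖ ≤ Lr ^ (k - j - 1) * bout.loc y HB)
    -- p29's located `s`-conditions at that `s`
    (hsmall : Real.exp (4 * (800 * ((d : ℝ) + 1) ^ 2 * ((d : ℝ) + 4)) * α₀)
      * (1 + 8 * (131072 * ((d : ℝ) + 1) ^ 2) * (Lr ^ (k - j - 1) * bout.loc y HB)) ≤ 2)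
    (hc₃ : 2 * (Lr ^ (k - j - 1) * bout.loc y HB) ≤ c3 d L) (hsm : 2048 * (d : ℝ) * (Lr ^ (k - j - 1) * bout.loc y HB) ≤ 1)
    (h1 : 128 * (Lr ^ (k - j - 1) * bout.loc y HB) ≤ 1) (hL1 : 1 ≤ L) :
    ‖((avgIter L
          (gaugeAct (B7Eq84Concrete.glev L hL1 U₀
              (expCfg (fun y μ => ((Complex.I : ℂ) * ((((L : ℝ) ^ j)⁻¹ : ℝ) : ℂ)) • H y μ)) j 0)⁻¹
            (expCfg (fun y μ => ((Complex.I : ℂ) * ((((L : ℝ) ^ j)⁻¹ : ℝ) : ℂ)) • H y μ) * U₀)) j q κ : 𝔸ˣ) : 𝔸)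
        * (((avgIter L U₀ j q κ)⁻¹ : 𝔸ˣ) : 𝔸) - 1‖
      ≤ (136 * ((d : ℝ) + 1) + 320 * d) * (44 * (d : ℝ) ^ 2 * B₃ ^ 2 * (1 + β₀)) * Real.exp (-R j) * εj := by
  have hdR : (0 : ℝ) < d := by exact_mod_cast hdpos
  have hs0 : 0 ≤ Lr ^ (k - j - 1) * bout.loc y HB :=
    mul_nonneg (pow_nonneg (by linarith) _) (bout.loc_nonneg _ _)
  have h137 := (ineq137_local hL hG hU₀ hα hα3 hα4 h52 H q κ hs0 hdom hsmall hc₃ hsm h1 hL1).1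
  exact boundHZ158_of_ineq190 h190 hC hd hrow hτ hστ B y hm hD hmv hgeom hCB hjk hLr hδM hR1 hstep hεk hεk0 hεj hβ₀
    hB₃ hdR h137 (by positivity)

/-- **«much smaller than δ′_j», ON THE LATTICE, FROM [15] (190) AND γ**: `dev < δ′_j` with `ε_j = g_jA₀(log g_j⁻²)^{p₀}`,
`δ′_j = g_jA₁(log g_j⁻²)^{p₁}`, `R_j = R` of (2.5). [cite: Balaban1989LargeFieldI, (1.54) p.187, (1.58) p.188; Balaban1988Convergent, (2.5) p.255] -/
theorem second154_lt_lattice_of_ineq190_gamma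
    {gB : B6.Geometry} {FB FA : Type} [AddCommGroup FB] [Module ℝ FB] [AddCommGroup FA] [Module ℝ FA]
    {T : Type*} {bB : BlockNorm gB FB} {bout : BlockNorm gB FA} {dH : T → FB →ₗ[ℝ] FA}
    {C δ₀ σ τ c D B₃ δ M εk εj β₀ Lr γ gj A₀ A₁ : ℝ} {R : ℕ → ℝ} {j k Rn r p₀ p₁ : ℕ}
    (h190 : ∀ t, Ineq190 bB bout (dH t) C δ₀) (hC : 0 ≤ C) (hd : ∀ a b : gB.Site, 0 ≤ gB.dist a b)
    (hrow : RowSum gB σ c) (hτ : 0 ≤ τ) (hστ : σ + τ ≤ δ₀ / 8) (B : FB) (y : gB.Site)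
    {d : ℕ} {𝔸 : Type*} [NormedRing 𝔸] [NormedAlgebra ℂ 𝔸] [CompleteSpace 𝔸] [NormOneClass 𝔸]
    {L : ℕ} (hL : 2 ≤ L) {G : Subgroup 𝔸ˣ} (hG : AvgClosed d L G)
    {U₀ : B7Prop1Explicit.Site d → Fin d → 𝔸ˣ} (hU₀ : ∀ x κ, U₀ x κ ∈ G) {α₀ : ℝ} (hα : 0 < α₀)
    (hα3 : C0 d * α₀ ≤ 1 / 3) (hα4 : 4 * α₀ ≤ c2' d L) (h52 : pdev U₀ < α₀ * (((L : ℝ) ^ j)⁻¹) ^ 2)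
    (H : B7Prop1Explicit.Site d → Fin d → 𝔸) (q : B7Prop1Explicit.Site d) (κ : Fin d)
    (hm : ∀ y', bB.loc y' B ≤ 44 * (d : ℝ) ^ 2 * B₃ * εk) (hD : ∀ y', bB.loc y' B ≠ 0 → D ≤ gB.dist y y')
    {HB : FA} (hmv : ∀ s : ℝ, (∀ t, bout.loc y (dH t B) ≤ s) → bout.loc y HB ≤ s)
    (hgeom : δ * 10 * M * (∑ l ∈ Finset.Ico (j + 1) k, R l) + δ * M * R k ≤ τ * D) (hCB : C * bB.κ * c ≤ B₃)
    (hjk : j < k) (hLr : 2 ≤ Lr) (hδM : Lr + 1 ≤ δ * M) (hR1 : ∀ l, 1 ≤ R l)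
    (hstep : ∀ l, j ≤ l → l < k → R l ≤ Lr * R (l + 1)) (hεk : εk ≤ (1 + β₀) * Real.sqrt ((k : ℝ) - j) * εj)
    (hεk0 : 0 ≤ εk) (hεj : 0 < εj) (hβ₀ : 0 ≤ β₀) (hB₃ : 0 < B₃) (hdpos : 0 < d)
    (hdom : ∀ y' μ, B7Prop1Local.InBox (B7Prop1Local.loK L j q) (B7Prop1Local.bondHiK L j q κ) y' →
      ‖H y' μ‖ ≤ Lr ^ (k - j - 1) * bout.loc y HB)
    (hsmall : Real.exp (4 * (800 * ((d : ℝ) + 1) ^ 2 * ((d : ℝ) + 4)) * α₀)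
      * (1 + 8 * (131072 * ((d : ℝ) + 1) ^ 2) * (Lr ^ (k - j - 1) * bout.loc y HB)) ≤ 2)
    (hc₃ : 2 * (Lr ^ (k - j - 1) * bout.loc y HB) ≤ c3 d L) (hsm : 2048 * (d : ℝ) * (Lr ^ (k - j - 1) * bout.loc y HB) ≤ 1)
    (h1 : 128 * (Lr ^ (k - j - 1) * bout.loc y HB) ≤ 1) (hL1 : 1 ≤ L)
    -- γ data and the p. 183 / [III] (2.4) letters
    (hRj : R j = (Rn : ℝ)) (hr : 1 ≤ r) (hp : p₁ ≤ p₀) (hRn : B14.IsRj L r gj Rn) (hgj : 0 < gj) (hgjγ : gj ≤ γ)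
    (hγe : 1 ≤ Real.log (γ ^ 2)⁻¹) (hA₀ : 0 ≤ A₀) (hεjdef : εj = gj * p0Profile A₀ p₀ gj)
    (hγ : (136 * ((d : ℝ) + 1) + 320 * d) * (44 * (d : ℝ) ^ 2 * B₃ ^ 2 * (1 + β₀)) * A₀
      * (2 * ((p₀ - p₁ : ℕ) : ℝ)) ^ (p₀ - p₁) * γ < A₁) :
    ‖((avgIter L
          (gaugeAct (B7Eq84Concrete.glev L hL1 U₀
              (expCfg (fun y μ => ((Complex.I : ℂ) * ((((L : ℝ) ^ j)⁻¹ : ℝ) : ℂ)) • H y μ)) j 0)⁻¹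
            (expCfg (fun y μ => ((Complex.I : ℂ) * ((((L : ℝ) ^ j)⁻¹ : ℝ) : ℂ)) • H y μ) * U₀)) j q κ : 𝔸ˣ) : 𝔸)
        * (((avgIter L U₀ j q κ)⁻¹ : 𝔸ˣ) : 𝔸) - 1‖ < gj * p0Profile A₁ p₁ gj := by
  have hle := second154_le_lattice_of_ineq190 h190 hC hd hrow hτ hστ B y hL hG hU₀ hα hα3 hα4 h52 H q κ hm hD hmv hgeom
    hCB hjk hLr hδM hR1 hstep hεk hεk0 hεj hβ₀ hB₃ hdpos hdom hsmall hc₃ hsm h1 hL1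
  have hCpos : 0 ≤ (136 * ((d : ℝ) + 1) + 320 * d) * (44 * (d : ℝ) ^ 2 * B₃ ^ 2 * (1 + β₀)) := by positivity
  have hlt := smallness158_hyp_of_gamma hr hp hRn hgj hgjγ hγe hCpos hA₀ hγ
  rw [hRj, hεjdef] at hle
  exact hle.trans_lt hlt

/-! ## §2 (v1.1). The located `s`-conditions from γ -/

/-- Monotonicity of p29's four located `s`-conditions: they pass from a majorant `S ≥ s ≥ 0` to `s` (`d ≥ 1` for
`128 ≤ 2048d`). [folklore] -/
private theorem located_of_le {d L : ℕ} {s S α₀ : ℝ} (hd1 : 1 ≤ d) (hs0 : 0 ≤ s) (hle : s ≤ S)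
    (hsmS : 2048 * (d : ℝ) * S ≤ 1) (hc₃S : 2 * S ≤ c3 d L)
    (hsmallS : Real.exp (4 * (800 * ((d : ℝ) + 1) ^ 2 * ((d : ℝ) + 4)) * α₀)
      * (1 + 8 * (131072 * ((d : ℝ) + 1) ^ 2) * S) ≤ 2) :
    Real.exp (4 * (800 * ((d : ℝ) + 1) ^ 2 * ((d : ℝ) + 4)) * α₀) * (1 + 8 * (131072 * ((d : ℝ) + 1) ^ 2) * s) ≤ 2 ∧
    2 * s ≤ c3 d L ∧ 2048 * (d : ℝ) * s ≤ 1 ∧ 128 * s ≤ 1 := by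
  have hd' : (1 : ℝ) ≤ d := by exact_mod_cast hd1
  have hexp : 0 ≤ Real.exp (4 * (800 * ((d : ℝ) + 1) ^ 2 * ((d : ℝ) + 4)) * α₀) := (Real.exp_pos _).le
  have hin : 1 + 8 * (131072 * ((d : ℝ) + 1) ^ 2) * s ≤ 1 + 8 * (131072 * ((d : ℝ) + 1) ^ 2) * S := by
    have := mul_le_mul_of_nonneg_left hle (by positivity : (0 : ℝ) ≤ 8 * (131072 * ((d : ℝ) + 1) ^ 2))
    linarith
  have h3 := mul_le_mul_of_nonneg_left hle (by positivity : (0 : ℝ) ≤ 2048 * (d : ℝ))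
  refine ⟨(mul_le_mul_of_nonneg_left hin hexp).trans hsmallS, by linarith, by linarith, ?_⟩
  have h2048 : 128 * s ≤ 2048 * (d : ℝ) * s := by nlinarith
  linarith

/-- **«much smaller than δ′_j», ON THE LATTICE, FROM [15] (190) AND γ — located side conditions from γ too**: as
`second154_lt_lattice_of_ineq190_gamma`, with p29's four located `s`-conditions (at `s = L^{k−j−1}·bout.loc y ℍB`) NOT assumed
but DERIVED: by (1.57) from (190) `s < 44d²B₃²(1+β₀)e^{−R_j}ε_j ≤ S_γ := 44d²B₃²(1+β₀)γ²` (`e^{−R_j} ≤ γ²` by (2.5), `ε_j ≤ 1`),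
so the explicit clauses `2048d·S_γ ≤ 1`, `2S_γ ≤ c₃(d,L)`, `exp(4·800(d+1)²(d+4)α₀)(1 + 8·131072(d+1)²S_γ) ≤ 2` (`d ≥ 1`)
suffice. [cite: Balaban1989LargeFieldI, (1.54) p.187, (1.57)–(1.58) p.188; Balaban1988Convergent, (2.5) p.255] -/
theorem second154_lt_lattice_of_ineq190_gamma'
    {gB : B6.Geometry} {FB FA : Type} [AddCommGroup FB] [Module ℝ FB] [AddCommGroup FA] [Module ℝ FA]
    {T : Type*} {bB : BlockNorm gB FB} {bout : BlockNorm gB FA} {dH : T → FB →ₗ[ℝ] FA}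
    {C δ₀ σ τ c D B₃ δ M εk εj β₀ Lr γ gj A₀ A₁ : ℝ} {R : ℕ → ℝ} {j k Rn r p₀ p₁ : ℕ}
    (h190 : ∀ t, Ineq190 bB bout (dH t) C δ₀) (hC : 0 ≤ C) (hd : ∀ a b : gB.Site, 0 ≤ gB.dist a b)
    (hrow : RowSum gB σ c) (hτ : 0 ≤ τ) (hστ : σ + τ ≤ δ₀ / 8) (B : FB) (y : gB.Site)
    {d : ℕ} {𝔸 : Type*} [NormedRing 𝔸] [NormedAlgebra ℂ 𝔸] [CompleteSpace 𝔸] [NormOneClass 𝔸]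
    {L : ℕ} (hL : 2 ≤ L) {G : Subgroup 𝔸ˣ} (hG : AvgClosed d L G)
    {U₀ : B7Prop1Explicit.Site d → Fin d → 𝔸ˣ} (hU₀ : ∀ x κ, U₀ x κ ∈ G) {α₀ : ℝ} (hα : 0 < α₀)
    (hα3 : C0 d * α₀ ≤ 1 / 3) (hα4 : 4 * α₀ ≤ c2' d L) (h52 : pdev U₀ < α₀ * (((L : ℝ) ^ j)⁻¹) ^ 2)
    (H : B7Prop1Explicit.Site d → Fin d → 𝔸) (q : B7Prop1Explicit.Site d) (κ : Fin d)
    (hm : ∀ y', bB.loc y' B ≤ 44 * (d : ℝ) ^ 2 * B₃ * εk) (hD : ∀ y', bB.loc y' B ≠ 0 → D ≤ gB.dist y y')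
    {HB : FA} (hmv : ∀ s : ℝ, (∀ t, bout.loc y (dH t B) ≤ s) → bout.loc y HB ≤ s)
    (hgeom : δ * 10 * M * (∑ l ∈ Finset.Ico (j + 1) k, R l) + δ * M * R k ≤ τ * D) (hCB : C * bB.κ * c ≤ B₃)
    (hjk : j < k) (hLr : 2 ≤ Lr) (hδM : Lr + 1 ≤ δ * M) (hR1 : ∀ l, 1 ≤ R l)
    (hstep : ∀ l, j ≤ l → l < k → R l ≤ Lr * R (l + 1)) (hεk : εk ≤ (1 + β₀) * Real.sqrt ((k : ℝ) - j) * εj)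
    (hεk0 : 0 ≤ εk) (hεj : 0 < εj) (hβ₀ : 0 ≤ β₀) (hB₃ : 0 < B₃) (hdpos : 0 < d)
    (hdom : ∀ y' μ, B7Prop1Local.InBox (B7Prop1Local.loK L j q) (B7Prop1Local.bondHiK L j q κ) y' →
      ‖H y' μ‖ ≤ Lr ^ (k - j - 1) * bout.loc y HB) (hL1 : 1 ≤ L)
    -- γ data and the p. 183 / [III] (2.4) letters
    (hRj : R j = (Rn : ℝ)) (hr : 1 ≤ r) (hp : p₁ ≤ p₀) (hRn : B14.IsRj L r gj Rn) (hgj : 0 < gj) (hgjγ : gj ≤ γ)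
    (hγe : 1 ≤ Real.log (γ ^ 2)⁻¹) (hA₀ : 0 ≤ A₀) (hεjdef : εj = gj * p0Profile A₀ p₀ gj)
    (hγ : (136 * ((d : ℝ) + 1) + 320 * d) * (44 * (d : ℝ) ^ 2 * B₃ ^ 2 * (1 + β₀)) * A₀
      * (2 * ((p₀ - p₁ : ℕ) : ℝ)) ^ (p₀ - p₁) * γ < A₁)
    -- the located conditions in γ/α₀ form
    (hd1 : 1 ≤ d) (hεj1 : εj ≤ 1)
    (hsmγ : 2048 * (d : ℝ) * (44 * (d : ℝ) ^ 2 * B₃ ^ 2 * (1 + β₀) * γ ^ 2) ≤ 1)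
    (hc₃γ : 2 * (44 * (d : ℝ) ^ 2 * B₃ ^ 2 * (1 + β₀) * γ ^ 2) ≤ c3 d L)
    (hsmallγ : Real.exp (4 * (800 * ((d : ℝ) + 1) ^ 2 * ((d : ℝ) + 4)) * α₀)
      * (1 + 8 * (131072 * ((d : ℝ) + 1) ^ 2) * (44 * (d : ℝ) ^ 2 * B₃ ^ 2 * (1 + β₀) * γ ^ 2)) ≤ 2) :
    ‖((avgIter L
          (gaugeAct (B7Eq84Concrete.glev L hL1 U₀
              (expCfg (fun y μ => ((Complex.I : ℂ) * ((((L : ℝ) ^ j)⁻¹ : ℝ) : ℂ)) • H y μ)) j 0)⁻¹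
            (expCfg (fun y μ => ((Complex.I : ℂ) * ((((L : ℝ) ^ j)⁻¹ : ℝ) : ℂ)) • H y μ) * U₀)) j q κ : 𝔸ˣ) : 𝔸)
        * (((avgIter L U₀ j q κ)⁻¹ : 𝔸ˣ) : 𝔸) - 1‖ < gj * p0Profile A₁ p₁ gj := by
  have hdR : (0 : ℝ) < d := by exact_mod_cast hdpos
  -- the size `s` and its bound from (1.57)/(190) and γ
  have hLpow : (0 : ℝ) ≤ Lr ^ (k - j - 1) := pow_nonneg (by linarith) _
  have hs0 : 0 ≤ Lr ^ (k - j - 1) * bout.loc y HB := mul_nonneg hLpow (bout.loc_nonneg _ _)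
  have hfirst := ineq157_first_of_ineq190 h190 hC hd hrow hτ hστ B y hm hD hmv hgeom hCB hLpow hB₃.le hεk0
  have hsecond := B15Ineq157Flow.ineq157_second hjk hLr hδM hR1 hstep hεk hεj hβ₀ hB₃ hdR
  have hexpγ : Real.exp (-R j) ≤ γ ^ 2 := by
    rw [hRj]; exact B15GammaSmallness.exp_neg_R_le_gamma_sq hr hRn hgj hgjγ hγe
  have hK : 0 ≤ 44 * (d : ℝ) ^ 2 * B₃ ^ 2 * (1 + β₀) := by positivity
  have hle : Lr ^ (k - j - 1) * bout.loc y HB ≤ 44 * (d : ℝ) ^ 2 * B₃ ^ 2 * (1 + β₀) * γ ^ 2 := by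
    have h3 : 44 * (d : ℝ) ^ 2 * B₃ ^ 2 * (1 + β₀) * Real.exp (-R j) * εj
        ≤ 44 * (d : ℝ) ^ 2 * B₃ ^ 2 * (1 + β₀) * γ ^ 2 * 1 := by
      have := mul_le_mul hexpγ hεj1 hεj.le (by positivity : (0 : ℝ) ≤ γ ^ 2)
      calc 44 * (d : ℝ) ^ 2 * B₃ ^ 2 * (1 + β₀) * Real.exp (-R j) * εj
          = 44 * (d : ℝ) ^ 2 * B₃ ^ 2 * (1 + β₀) * (Real.exp (-R j) * εj) := by ring
        _ ≤ 44 * (d : ℝ) ^ 2 * B₃ ^ 2 * (1 + β₀) * (γ ^ 2 * 1) := mul_le_mul_of_nonneg_left this hK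
        _ = _ := by ring
    linarith [hfirst, hsecond, h3]
  obtain ⟨hsmall, hc₃, hsm, h1⟩ := located_of_le (L := L) hd1 hs0 hle hsmγ hc₃γ hsmallγ
  exact second154_lt_lattice_of_ineq190_gamma h190 hC hd hrow hτ hστ B y hL hG hU₀ hα hα3 hα4 h52 H q κ hm hD hmv hgeom
    hCB hjk hLr hδM hR1 hstep hεk hεk0 hεj hβ₀ hB₃ hdpos hdom hsmall hc₃ hsm h1 hL1 hRj hr hp hRn hgj hgjγ hγe hA₀ hεjdef hγ

end Literature.MathematicalPhysics.QuantumFieldTheory.Balaban1983to89.B15Ineq154From190
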